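import Summits.QuantumFields.YangMills.Theorems.FradkinShenkerFlowStrongPinningPoincareWords

/-!
# The Wilson action on the torus: word decomposition, slot counting, pinning sums

Lattice-side helpers for `StrongPinningPoincare` (continued): the Wilson action of the discrete
torus is a sum of words of length four in the link variables (`wilsonAction_eq_sum_words`), every
link occupies at most `4d` plaquette slots uniformly in the volume (`sum_slotCount_le`, also for
the degenerate tori of side `1` and `2`), whence the mixed Lipschitz bound
`abs_dd_wilsonAction_le` with column sums `≤ 16 d`; and elementary facts about the pinning
functional `U ↦ ∑_ℓ Re tr ρ(X_ℓ⁻¹ U_ℓ)`.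
-/

noncomputable section

open MeasureTheory Function Real
open scoped Matrix
open Literature.MathematicalPhysics.QuantumFieldTheory

namespace Summit.QuantumFields.YangMills.Theorems.StrongPinningPoincare

namespace Lattice

/-! ### The torus: Wilson action as a sum of words, and slot-incidence counting -/

section Torus

variable {d L N : ℕ} [NeZero L] {G : Type*} [Group G] (ρ : G →* Matrix (Fin N) (Fin N) ℂ)

/-- **The Wilson action is a sum of words of length four**: with the slot links
`e(p) = ((y,a), (y+e_a,b), (y+e_b,a), (y,b))` of the plaquette `p = (y, a<b)`,
`S_W(W) = ∑ₚ (N − Re tr(ρ(W e₀) ρ(W e₁) ρ(W e₂)ᴴ ρ(W e₃)ᴴ))` for unitary `ρ`. [folklore] -/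
theorem wilsonAction_eq_sum_words (hρu : ∀ g, ρ g ∈ Matrix.unitaryGroup (Fin N) ℂ)
    (W : GaugeConfig d L G) :
    wilsonAction ρ W = ∑ p : Plaquette d L, ((N : ℝ) -
      (ρ (W ((![(p.1, p.2.1.1), (p.1.shift p.2.1.1, p.2.1.2), (p.1.shift p.2.1.2, p.2.1.1),
          (p.1, p.2.1.2)] : Fin 4 → Edge d L) 0)) *
        ρ (W ((![(p.1, p.2.1.1), (p.1.shift p.2.1.1, p.2.1.2), (p.1.shift p.2.1.2, p.2.1.1),
          (p.1, p.2.1.2)] : Fin 4 → Edge d L) 1)) *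
        (ρ (W ((![(p.1, p.2.1.1), (p.1.shift p.2.1.1, p.2.1.2), (p.1.shift p.2.1.2, p.2.1.1),
          (p.1, p.2.1.2)] : Fin 4 → Edge d L) 2)))ᴴ *
        (ρ (W ((![(p.1, p.2.1.1), (p.1.shift p.2.1.1, p.2.1.2), (p.1.shift p.2.1.2, p.2.1.1),
          (p.1, p.2.1.2)] : Fin 4 → Edge d L) 3)))ᴴ).trace.re) := by
  unfold wilsonAction
  refine Finset.sum_congr rfl fun p _ => ?_
  simp only [plaquetteHolonomy, map_mul, map_inv_eq_conjTranspose ρ hρu, Matrix.cons_val_zero,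
    Matrix.cons_val_one]
  rfl

/-- **Slot-incidence count on the torus**: every link occupies at most `4d` plaquette slots,
`∑ₚ nⱼ(p) ≤ 4d` (each of the four slot maps `p ↦ eₖ(p)` has fibres of size `≤ d`). [folklore] -/
theorem sum_slotCount_le (j : Edge d L) :
    ∑ p : Plaquette d L, (∑ k : Fin 4, if (![(p.1, p.2.1.1), (p.1.shift p.2.1.1, p.2.1.2),
        (p.1.shift p.2.1.2, p.2.1.1), (p.1, p.2.1.2)] : Fin 4 → Edge d L) k = j then (1 : ℝ) else 0)
      ≤ 4 * d := by
  classical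
  rw [Finset.sum_comm]
  -- each slot map has fibres of cardinality at most `d`
  have hfib : ∀ k : Fin 4, (∑ p : Plaquette d L, if (![(p.1, p.2.1.1), (p.1.shift p.2.1.1, p.2.1.2),
      (p.1.shift p.2.1.2, p.2.1.1), (p.1, p.2.1.2)] : Fin 4 → Edge d L) k = j then (1 : ℝ) else 0)
      ≤ d := by
    intro k
    rw [Finset.sum_boole]
    norm_cast
    refine le_trans (?_ : _ ≤ (Finset.univ : Finset (Fin d)).card) (by simp)
    have hshift : ∀ (y y' : Site d L) (a : Fin d), y.shift a = y'.shift a → y = y' :=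
      fun y y' a h => add_right_cancel h
    fin_cases k
    · -- slot 0: `p ↦ (p.1, a)`; inject by `b`
      refine Finset.card_le_card_of_injOn (fun p => p.2.1.2) (fun _ _ => Finset.mem_univ _) ?_
      intro p hp p' hp' hb
      simp only [Finset.coe_filter, Finset.mem_univ, true_and, Set.mem_setOf_eq] at hp hp'
      change (p.1, p.2.1.1) = j at hp
      change (p'.1, p'.2.1.1) = j at hp'
      have h1 : p.1 = p'.1 := (congrArg Prod.fst hp).trans (congrArg Prod.fst hp').symm
      have h2 : p.2.1.1 = p'.2.1.1 := (congrArg Prod.snd hp).trans (congrArg Prod.snd hp').symm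
      exact Prod.ext h1 (Subtype.ext (Prod.ext h2 hb))
    · -- slot 1: `p ↦ (p.1 + e_a, b)`; inject by `a`
      refine Finset.card_le_card_of_injOn (fun p => p.2.1.1) (fun _ _ => Finset.mem_univ _) ?_
      intro p hp p' hp' ha
      simp only [Finset.coe_filter, Finset.mem_univ, true_and, Set.mem_setOf_eq] at hp hp'
      change (p.1.shift p.2.1.1, p.2.1.2) = j at hp
      change (p'.1.shift p'.2.1.1, p'.2.1.2) = j at hp'
      have ha' : p.2.1.1 = p'.2.1.1 := ha
      have h1 : p.1 = p'.1 := by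
        refine hshift _ _ p.2.1.1 ?_
        have := (congrArg Prod.fst hp).trans (congrArg Prod.fst hp').symm
        rwa [← ha'] at this
      have h2 : p.2.1.2 = p'.2.1.2 := (congrArg Prod.snd hp).trans (congrArg Prod.snd hp').symm
      exact Prod.ext h1 (Subtype.ext (Prod.ext ha' h2))
    · -- slot 2: `p ↦ (p.1 + e_b, a)`; inject by `b`
      refine Finset.card_le_card_of_injOn (fun p => p.2.1.2) (fun _ _ => Finset.mem_univ _) ?_
      intro p hp p' hp' hb
      simp only [Finset.coe_filter, Finset.mem_univ, true_and, Set.mem_setOf_eq] at hp hp'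
      have hb' : p.2.1.2 = p'.2.1.2 := hb
      change (p.1.shift p.2.1.2, p.2.1.1) = j at hp
      change (p'.1.shift p'.2.1.2, p'.2.1.1) = j at hp'
      have h1 : p.1 = p'.1 := by
        refine hshift _ _ p.2.1.2 ?_
        have := (congrArg Prod.fst hp).trans (congrArg Prod.fst hp').symm
        rwa [← hb'] at this
      have h2 : p.2.1.1 = p'.2.1.1 := (congrArg Prod.snd hp).trans (congrArg Prod.snd hp').symm
      exact Prod.ext h1 (Subtype.ext (Prod.ext h2 hb'))
    · -- slot 3: `p ↦ (p.1, b)`; inject by `a`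
      refine Finset.card_le_card_of_injOn (fun p => p.2.1.1) (fun _ _ => Finset.mem_univ _) ?_
      intro p hp p' hp' ha
      simp only [Finset.coe_filter, Finset.mem_univ, true_and, Set.mem_setOf_eq] at hp hp'
      have ha' : p.2.1.1 = p'.2.1.1 := ha
      change (p.1, p.2.1.2) = j at hp
      change (p'.1, p'.2.1.2) = j at hp'
      have h1 : p.1 = p'.1 := (congrArg Prod.fst hp).trans (congrArg Prod.fst hp').symm
      have h2 : p.2.1.2 = p'.2.1.2 := (congrArg Prod.snd hp).trans (congrArg Prod.snd hp').symm
      exact Prod.ext h1 (Subtype.ext (Prod.ext ha' h2))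
  calc _ ≤ ∑ _k : Fin 4, (d : ℝ) := Finset.sum_le_sum fun k _ => hfib k
    _ = 4 * d := by simp

/-- **Column sums of the slot-incidence matrix**: `∑ᵢ ∑ₚ nᵢ(p) nⱼ(p) ≤ 16 d` (`∑ᵢ nᵢ(p) = 4`,
`∑ₚ nⱼ(p) ≤ 4d`). [folklore] -/
theorem sum_sum_slotCount_mul_le (j : Edge d L) :
    ∑ i : Edge d L, ∑ p : Plaquette d L,
      (∑ k : Fin 4, if (![(p.1, p.2.1.1), (p.1.shift p.2.1.1, p.2.1.2),
        (p.1.shift p.2.1.2, p.2.1.1), (p.1, p.2.1.2)] : Fin 4 → Edge d L) k = i then (1 : ℝ) else 0) *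
      (∑ k : Fin 4, if (![(p.1, p.2.1.1), (p.1.shift p.2.1.1, p.2.1.2),
        (p.1.shift p.2.1.2, p.2.1.1), (p.1, p.2.1.2)] : Fin 4 → Edge d L) k = j then (1 : ℝ) else 0)
      ≤ 16 * d := by
  classical
  rw [Finset.sum_comm]
  have hrow : ∀ p : Plaquette d L, ∑ i : Edge d L,
      (∑ k : Fin 4, if (![(p.1, p.2.1.1), (p.1.shift p.2.1.1, p.2.1.2),
        (p.1.shift p.2.1.2, p.2.1.1), (p.1, p.2.1.2)] : Fin 4 → Edge d L) k = i then (1 : ℝ) else 0)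
      = 4 := fun p => by
    rw [Finset.sum_comm]
    simp [Finset.sum_ite_eq]
  simp_rw [← Finset.sum_mul, hrow]
  rw [← Finset.mul_sum]
  have h := sum_slotCount_le (d := d) (L := L) j
  linarith

/-- **Mixed Lipschitz bound for the Wilson action on the torus**: for links `i ≠ j`,
`|S_W(x[j↦a][i↦g]) − S_W(x[i↦g]) − S_W(x[j↦a][i↦g']) + S_W(x[i↦g'])|
  ≤ √N ‖ρ g − ρ g'‖_F ‖ρ(x j) − ρ a‖_F · m(i,j)`, `m(i,j) = ∑ₚ nᵢ(p) nⱼ(p)`. [folklore] -/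
theorem abs_dd_wilsonAction_le (hρu : ∀ g, ρ g ∈ Matrix.unitaryGroup (Fin N) ℂ)
    (x : GaugeConfig d L G) {i j : Edge d L} (hij : i ≠ j) (a g g' : G) :
    |wilsonAction ρ (update (update x j a) i g) - wilsonAction ρ (update x i g) -
        wilsonAction ρ (update (update x j a) i g') + wilsonAction ρ (update x i g')|
      ≤ Real.sqrt N * frobNorm (ρ g - ρ g') * frobNorm (ρ (x j) - ρ a) *
        ∑ p : Plaquette d L,
          (∑ k : Fin 4, if (![(p.1, p.2.1.1), (p.1.shift p.2.1.1, p.2.1.2),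
            (p.1.shift p.2.1.2, p.2.1.1), (p.1, p.2.1.2)] : Fin 4 → Edge d L) k = i then (1 : ℝ) else 0) *
          (∑ k : Fin 4, if (![(p.1, p.2.1.1), (p.1.shift p.2.1.1, p.2.1.2),
            (p.1.shift p.2.1.2, p.2.1.1), (p.1, p.2.1.2)] : Fin 4 → Edge d L) k = j then (1 : ℝ) else 0) := by
  classical
  simp only [wilsonAction_eq_sum_words ρ hρu]
  exact abs_dd_energy_le ρ hρu _ _ x hij a g g'

end Torus

/-! ### Pinning sums, traces of unitaries, the Frobenius distance -/

section Pin

variable {ι : Type*} [Fintype ι] [DecidableEq ι] {N : ℕ} {G : Type*} [Group G]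
  (ρ : G →* Matrix (Fin N) (Fin N) ℂ)

/-- Updating one link changes the pinning sum `∑_ℓ Re tr ρ(X_ℓ⁻¹ U_ℓ)` only through that link:
`∑_ℓ Re tr ρ(X_ℓ⁻¹ (U[i↦u])_ℓ) = Re tr ρ(X_i⁻¹ u) + ∑_{ℓ ≠ i} Re tr ρ(X_ℓ⁻¹ U_ℓ)`. [folklore] -/
theorem sum_pin_update (X U : ι → G) (i : ι) (u : G) :
    ∑ ℓ, (ρ ((X ℓ)⁻¹ * update U i u ℓ)).trace.re =
      (ρ ((X i)⁻¹ * u)).trace.re + ∑ ℓ ∈ Finset.univ.erase i, (ρ ((X ℓ)⁻¹ * U ℓ)).trace.re := by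
  rw [← Finset.add_sum_erase _ _ (Finset.mem_univ i), update_self]
  congr 1
  exact Finset.sum_congr rfl fun ℓ hℓ => by rw [update_of_ne (Finset.ne_of_mem_erase hℓ)]

omit [Fintype ι] [DecidableEq ι] in
/-- `|Re tr U| ≤ N` for a unitary `N × N` matrix. [folklore] -/
theorem abs_re_trace_unitary_le {U : Matrix (Fin N) (Fin N) ℂ}
    (hU : U ∈ Matrix.unitaryGroup (Fin N) ℂ) : |U.trace.re| ≤ N := by
  have h1 : frobNorm U = Real.sqrt N := by
    rw [← Real.sqrt_sq (frobNorm_nonneg U), frobNorm_sq_of_mem_unitaryGroup hU, Fintype.card_fin]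
  have h := abs_re_trace_le U
  rw [h1, Fintype.card_fin, Real.mul_self_sqrt (Nat.cast_nonneg N)] at h
  exact h

omit [Fintype ι] [DecidableEq ι] in
/-- The Frobenius norm is continuous (entries are continuous). [folklore] -/
theorem continuous_frobNorm {n : Type*} [Fintype n] :
    Continuous (frobNorm : Matrix n n ℂ → ℝ) := by
  unfold frobNorm
  refine Real.continuous_sqrt.comp (continuous_finsetSum _ fun i _ =>
    continuous_finsetSum _ fun j _ => ?_)
  exact (((continuous_apply j).comp (continuous_apply i)).norm).pow 2

omit [Fintype ι] [DecidableEq ι] in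
/-- `‖A‖_F = 0` forces `A = 0`. [folklore] -/
theorem eq_zero_of_frobNorm_eq_zero {n : Type*} [Fintype n] {A : Matrix n n ℂ}
    (h : frobNorm A = 0) : A = 0 := by
  ext i j
  have hij := norm_entry_le_frobNorm A i j
  rw [h] at hij
  exact norm_le_zero_iff.1 hij

omit [Fintype ι] [DecidableEq ι] in
/-- `g ↦ Re tr ρ(h g)` is continuous for a continuous representation. [folklore] -/
theorem continuous_re_trace_mul [TopologicalSpace G] [IsTopologicalGroup G] (hρ : Continuous ρ)
    (h : G) : Continuous fun g => (ρ (h * g)).trace.re :=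
  Complex.continuous_re.comp ((hρ.comp (continuous_const.mul continuous_id)).matrix_trace)

end Pin

end Lattice

end Summit.QuantumFields.YangMills.Theorems.StrongPinningPoincare

end
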